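import Literature.Analysis.InverseSpectral.KreinStringContinuity
import HarnessLib

/-!
# The continuity theorem for Kreĭn strings on the negative axis

**Kasahara–Kotani–Watanabe continuity theorem** (negative-axis form): if strings `T_n` converge
to a string `S` in the sense that the mass functions converge at almost every point of `[0, L)`
(eventually inside `T_n`) and explode beyond `L`, then `q_{T_n}(-s) → q_S(-s)` for every `s > 0`
(`tendsto_weyl_neg_of_mass_tendsto`). Part 1 is the **stability of the fundamental system**:
`φ_n(·,-s) → φ(·,-s)` uniformly on compact pieces (`tendsto_phi_neg_uniformly`), proved by
comparing the integral equations `φ = 1 + s ∫₀ˣ ∫_{[0,u]} φ dm du` — the difference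
`δ_n = φ_n - φ` satisfies `|δ_n| ≤ A_n + s K_n |δ_n|` with the Volterra operator `K_n` of `S_n` and
an error `A_n → 0` (integration by parts against `m_n - m`), and **Grönwall's lemma takes the
`|δ_n| ≤ A_n φ_n(·,-s)`** (`le_mul_phi_of_le_add_picard`). Part 2 gives the lower bound for
`q_{T_n}(-s)` from Part 1 and the upper bound from tail estimates
`∫ₓ^{L_n} φ_n⁻² ≤ (s m_n(a)(1 + s m_n(a)(x-a)))⁻¹` (mass at `a`) and `≤ L + δ - x` (short remaining
interval), according to whether `S` is long, heavy at its end, or regular.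
(Kasahara 1975; Kotani–Watanabe 1982 §2; Kac–Kreĭn 1974 §11.)

## References

KacKrein1974 (§11), KotaniWatanabe1982 (§2), Kasahara1975.
-/

open MeasureTheory Filter Set Topology Finset
open scoped ENNReal

noncomputable section

namespace Literature.Analysis.InverseSpectral

namespace KreinString

variable (S : KreinString)

/-! ### Integration by parts against a second string, and the Volterra operator -/

/-- The Volterra operator as an iterated integral (real form):
`∫_{[0,t]} (t-u) g(u) dm(u) = ∫₀ᵗ (∫_{[0,u]} g dm) du`. [folklore] -/
lemma picard_one_eq_integral_integral {g : ℝ → ℝ} {t : ℝ} (ht : t ∈ S.dom)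
    (hg : ContinuousOn g (Icc 0 t)) :
    S.picard g 1 t = ∫ u in Icc 0 t, (∫ v in Icc 0 u, g v ∂S.massMeasure) := by
  rw [picard_succ, picard_zero]
  have h := integral_sub_mul_eq_integral_integral ht.1 (S.massMeasure_Icc_lt_top ht).ne
    (g := fun v => (g v : ℂ)) (S.integrableOn_Icc_of_continuousOn ht
      (Complex.continuous_ofReal.comp_continuousOn hg))
  have h1 : ∫ u in Icc 0 t, ((t - u : ℝ) : ℂ) * (g u : ℂ) ∂S.massMeasure =
      ((∫ u in Icc 0 t, (t - u) * g u ∂S.massMeasure : ℝ) : ℂ) := by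
    rw [← integral_complex_ofReal]
    refine integral_congr_ae (ae_of_all _ fun u => ?_)
    push_cast
    ring
  have h2 : ∫ u in Icc 0 t, (∫ v in Icc 0 u, (g v : ℂ) ∂S.massMeasure) =
      ((∫ u in Icc 0 t, (∫ v in Icc 0 u, g v ∂S.massMeasure) : ℝ) : ℂ) := by
    rw [← integral_complex_ofReal]
    refine integral_congr_ae (ae_of_all _ fun u => ?_)
    dsimp only
    exact (integral_complex_ofReal (f := g) (μ := S.massMeasure.restrict (Icc 0 u)))
  rw [h1, h2] at h
  exact_mod_cast h

/-- A function continuous on `[0, u]` is integrable there against any measure finite on `[0, u]`.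
[folklore] -/
lemma integrableOn_Icc_of_continuousOn_of_ne_top {E : Type*} [NormedAddCommGroup E] {u : ℝ}
    {ν : Measure ℝ} (hν : ν (Icc 0 u) ≠ ⊤) {f : ℝ → E} (hf : ContinuousOn f (Icc 0 u)) :
    IntegrableOn f (Icc 0 u) ν := by
  haveI : IsFiniteMeasure (ν.restrict (Icc 0 u)) := isFiniteMeasure_restrict.2 hν
  obtain ⟨M, hM⟩ := isCompact_Icc.exists_bound_of_continuousOn hf
  refine Integrable.mono' (integrable_const M) (hf.aestronglyMeasurable measurableSet_Icc) ?_
  rw [ae_restrict_iff' measurableSet_Icc]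
  exact ae_of_all _ hM

/-- **Integration by parts of `φ(·,z)` of one string against the mass of another**:
`∫_{[0,u]} φ dν = φ(u) ν[0,u] + z ∫₀ᵘ Φ(t) ν[0,t] dt`, `Φ(t) = ∫_{[0,t]} φ dm`
(`φ⁺' = -z Φ`). [folklore] -/
theorem setIntegral_phi_eq_parts (z : ℂ) {u : ℝ} (hu : u ∈ S.dom) {ν : Measure ℝ}
    (hν : ν (Icc 0 u) ≠ ⊤) :
    ∫ t in Icc 0 u, S.phi z t ∂ν = S.phi z u * (ν (Icc 0 u)).toReal -
      (-z) * ∫ t in Icc 0 u, (∫ v in Icc 0 t, S.phi z v ∂S.massMeasure) * (ν (Icc 0 t)).toReal := by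
  haveI : IsFiniteMeasure (ν.restrict (Icc 0 u)) := isFiniteMeasure_restrict.2 hν
  set Φ : ℝ → ℂ := fun t => ∫ v in Icc 0 t, S.phi z v ∂S.massMeasure with hΦ
  have hφc : ContinuousOn (S.phi z) (Icc 0 u) := (S.isSolution_phi z).1.mono (S.Icc_subset_dom hu)
  have hΦi : IntegrableOn Φ (Icc 0 u) :=
    integrableOn_integral_Icc (S.massMeasure_Icc_lt_top hu).ne
      (S.integrableOn_Icc_of_continuousOn hu hφc)
  have hφν : IntegrableOn (S.phi z) (Icc 0 u) ν := integrableOn_Icc_of_continuousOn_of_ne_top hν hφc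
  -- by parts with `a = -z Φ` (so that `∫₀ᵗ a = φ(t) - 1`) and `b = 1`
  have h := integral_mul_integral_eq_parts hν (a := fun t => (-z) * Φ t) (b := fun _ => (1 : ℂ))
    (hΦi.const_mul _) (integrable_const _)
  have hprim : ∀ t ∈ Icc 0 u, ∫ v in Icc 0 t, (-z) * Φ v = S.phi z t - 1 := fun t ht => by
    rw [integral_const_mul, S.phi_eq_one_sub_integral z (S.Icc_subset_dom hu ht)]
    ring
  have hone : ∀ t, ∫ _ in Icc 0 t, (1 : ℂ) ∂ν = ((ν (Icc 0 t)).toReal : ℂ) := fun t => by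
    rw [setIntegral_const, Complex.real_smul, mul_one, measureReal_def]
  have h3 : ∫ t in Icc 0 u, (1 : ℂ) * (∫ v in Icc 0 t, (-z) * Φ v) ∂ν =
      (∫ t in Icc 0 u, S.phi z t ∂ν) - ((ν (Icc 0 u)).toReal : ℂ) := by
    rw [setIntegral_congr_fun measurableSet_Icc (fun t ht => by rw [one_mul, hprim t ht]),
      integral_sub hφν (integrable_const _), hone u]
  have h4 : ∫ t in Icc 0 u, (-z) * Φ t * (∫ _ in Icc 0 t, (1 : ℂ) ∂ν) =
      (-z) * ∫ t in Icc 0 u, Φ t * ((ν (Icc 0 t)).toReal : ℂ) := by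
    rw [← integral_const_mul]
    refine setIntegral_congr_fun measurableSet_Icc (fun t _ => ?_)
    rw [hone t]
    ring
  rw [hprim u ⟨hu.1, le_rfl⟩, hone u, h3, h4] at h
  linear_combination -h

/-! ### Grönwall's lemma via the string -/

/-- The Volterra operator of the string is monotone. [folklore] -/
lemma picard_mono {f g : ℝ → ℝ} {X : ℝ} (hX : X ∈ S.dom) (hf : ContinuousOn f (Icc 0 X))
    (hg : ContinuousOn g (Icc 0 X)) (hfg : ∀ t ∈ Icc 0 X, f t ≤ g t) (n : ℕ) :
    ∀ t ∈ Icc 0 X, S.picard f n t ≤ S.picard g n t := by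
  induction n with
  | zero => simpa using hfg
  | succ n ih =>
    intro t ht
    rw [picard_succ, picard_succ]
    have htd : t ∈ S.dom := S.Icc_subset_dom hX ht
    have hsub : Icc 0 t ⊆ Icc 0 X := Icc_subset_Icc_right ht.2
    refine setIntegral_mono_on ?_ ?_ measurableSet_Icc (fun u hu => ?_)
    · exact S.integrableOn_Icc_of_continuousOn htd ((continuousOn_const.sub continuousOn_id).mul
        ((S.continuousOn_picard hX hf n).mono hsub))
    · exact S.integrableOn_Icc_of_continuousOn htd ((continuousOn_const.sub continuousOn_id).mul
        ((S.continuousOn_picard hX hg n).mono hsub))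
    · exact mul_le_mul_of_nonneg_left (ih u (hsub hu)) (sub_nonneg.2 hu.2)

/-- One Volterra step applied to the Grönwall majorant
`A Σ_{j<k} sʲ Kʲ1 + sᵏ Kᵏ g`. [folklore] -/
lemma picard_one_majorant {g : ℝ → ℝ} {X A s : ℝ} (hX : X ∈ S.dom) (hg : ContinuousOn g (Icc 0 X))
    (k : ℕ) {t : ℝ} (ht : t ∈ Icc 0 X) :
    ∫ u in Icc 0 t, (t - u) * (A * (∑ j ∈ range k, s ^ j * S.picard (fun _ => (1 : ℝ)) j u) +
        s ^ k * S.picard g k u) ∂S.massMeasure =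
      A * (∑ j ∈ range k, s ^ j * S.picard (fun _ => (1 : ℝ)) (j + 1) t) +
        s ^ k * S.picard g (k + 1) t := by
  have htd : t ∈ S.dom := S.Icc_subset_dom hX ht
  have hsub : Icc 0 t ⊆ Icc 0 X := Icc_subset_Icc_right ht.2
  have hk : ContinuousOn (fun u : ℝ => t - u) (Icc 0 t) := continuousOn_const.sub continuousOn_id
  have hpj : ∀ j, IntegrableOn (fun u => (t - u) * S.picard (fun _ => (1 : ℝ)) j u) (Icc 0 t)
      S.massMeasure := fun j =>
    S.integrableOn_Icc_of_continuousOn htd (hk.mul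
      ((S.continuousOn_picard hX continuousOn_const j).mono hsub))
  have hpg : IntegrableOn (fun u => (t - u) * S.picard g k u) (Icc 0 t) S.massMeasure :=
    S.integrableOn_Icc_of_continuousOn htd (hk.mul ((S.continuousOn_picard hX hg k).mono hsub))
  have hsumint : IntegrableOn
      (fun u => ∑ j ∈ range k, s ^ j * ((t - u) * S.picard (fun _ => (1 : ℝ)) j u)) (Icc 0 t)
      S.massMeasure :=
    integrable_finsetSum _ (fun j _ => (hpj j).const_mul _)
  have heq : ∀ u ∈ Icc 0 t,
      (t - u) * (A * (∑ j ∈ range k, s ^ j * S.picard (fun _ => (1 : ℝ)) j u) +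
        s ^ k * S.picard g k u) =
      A * (∑ j ∈ range k, s ^ j * ((t - u) * S.picard (fun _ => (1 : ℝ)) j u)) +
        s ^ k * ((t - u) * S.picard g k u) := fun u _ => by
    rw [mul_add]
    congr 1
    · rw [Finset.mul_sum, Finset.mul_sum, Finset.mul_sum]
      exact Finset.sum_congr rfl (fun j _ => by ring)
    · ring
  rw [setIntegral_congr_fun measurableSet_Icc heq, integral_add (hsumint.const_mul A)
    (hpg.const_mul _), integral_const_mul, integral_const_mul, integral_finsetSum _
    (fun j _ => (hpj j).const_mul _)]
  congr 1
  · congr 1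
    refine Finset.sum_congr rfl (fun j _ => ?_)
    rw [integral_const_mul, picard_succ]

/-- **Grönwall's lemma via the string**: if `g` is continuous on `[0, X]` and
`g ≤ A + s · K g` with the Volterra operator `K` of the string (`s ≥ 0`), then `g ≤ A φ(·, -s)`
on `[0, X]` — the iterates of the inequality reproduce the Picard series of `φ(·,-s)`.
[cite: KacKrein1974, §1] -/
theorem le_mul_phi_of_le_add_picard {g : ℝ → ℝ} {X A s : ℝ} (hX : X ∈ S.dom)
    (hg : ContinuousOn g (Icc 0 X)) (hs : 0 ≤ s)
    (hle : ∀ t ∈ Icc 0 X, g t ≤ A + s * S.picard g 1 t) :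
    ∀ t ∈ Icc 0 X, g t ≤ A * (S.phi (-(s : ℂ)) t).re := by
  -- the iterated inequality
  have hiter : ∀ k : ℕ, ∀ t ∈ Icc 0 X,
      g t ≤ A * (∑ j ∈ range k, s ^ j * S.picard (fun _ => (1 : ℝ)) j t) +
        s ^ k * S.picard g k t := by
    intro k
    induction k with
    | zero => intro t ht; simp
    | succ k ih =>
      intro t ht
      have htd : t ∈ S.dom := S.Icc_subset_dom hX ht
      have hsub : Icc 0 t ⊆ Icc 0 X := Icc_subset_Icc_right ht.2
      -- monotonicity of the Volterra step applied to the induction hypothesis on `[0, t]`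
      have hmono : S.picard g 1 t ≤
          ∫ u in Icc 0 t, (t - u) * (A * (∑ j ∈ range k, s ^ j * S.picard (fun _ => (1 : ℝ)) j u) +
            s ^ k * S.picard g k u) ∂S.massMeasure := by
        rw [picard_succ, picard_zero]
        have hk : ContinuousOn (fun u : ℝ => t - u) (Icc 0 t) :=
          continuousOn_const.sub continuousOn_id
        have hmaj : ContinuousOn (fun u => A * (∑ j ∈ range k, s ^ j *
            S.picard (fun _ => (1 : ℝ)) j u) + s ^ k * S.picard g k u) (Icc 0 X) := by
          refine (continuousOn_const.mul (continuousOn_finsetSum _ (fun j _ => ?_))).add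
            (continuousOn_const.mul (S.continuousOn_picard hX hg k))
          exact continuousOn_const.mul (S.continuousOn_picard hX continuousOn_const j)
        refine setIntegral_mono_on ?_ ?_ measurableSet_Icc (fun u hu => ?_)
        · exact S.integrableOn_Icc_of_continuousOn htd (hk.mul (hg.mono hsub))
        · exact S.integrableOn_Icc_of_continuousOn htd (hk.mul (hmaj.mono hsub))
        · exact mul_le_mul_of_nonneg_left (ih u (hsub hu)) (sub_nonneg.2 hu.2)
      rw [S.picard_one_majorant hX hg k ht] at hmono
      calc g t ≤ A + s * S.picard g 1 t := hle t ht
        _ ≤ A + s * (A * (∑ j ∈ range k, s ^ j * S.picard (fun _ => (1 : ℝ)) (j + 1) t) +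
              s ^ k * S.picard g (k + 1) t) := by gcongr
        _ = A * (∑ j ∈ range (k + 1), s ^ j * S.picard (fun _ => (1 : ℝ)) j t) +
              s ^ (k + 1) * S.picard g (k + 1) t := by
            have e1 : s * (A * ∑ j ∈ range k, s ^ j * S.picard (fun _ => (1 : ℝ)) (j + 1) t) =
                A * ∑ j ∈ range k, s ^ (j + 1) * S.picard (fun _ => (1 : ℝ)) (j + 1) t := by
              rw [Finset.mul_sum, Finset.mul_sum, Finset.mul_sum]
              exact Finset.sum_congr rfl (fun j _ => by ring)
            rw [Finset.sum_range_succ', mul_add s, e1]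
            simp only [pow_zero, picard_zero, one_mul]
            ring
  -- pass to the limit `k → ∞`
  intro t ht
  have htd : t ∈ S.dom := S.Icc_subset_dom hX ht
  obtain ⟨M, hM⟩ := isCompact_Icc.exists_bound_of_continuousOn hg
  have hM0 : 0 ≤ M := (norm_nonneg _).trans (hM 0 ⟨le_rfl, ht.1.trans ht.2⟩)
  have hsum := S.summable_picard_neg continuous_const s htd (f := fun _ => (1 : ℝ))
  have h1 : Tendsto (fun k => A * (∑ j ∈ range k, s ^ j * S.picard (fun _ => (1 : ℝ)) j t))
      atTop (𝓝 (A * (S.phi (-(s : ℂ)) t).re)) := by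
    rw [S.phi_neg_re]
    exact (hsum.hasSum.tendsto_sum_nat).const_mul A
  have h2 : Tendsto (fun k => s ^ k * S.picard g k t) atTop (𝓝 0) := by
    -- `|sᵏ Kᵏ g| ≤ M (s m(X) X)ᵏ / k! → 0`
    have hb : ∀ k, |s ^ k * S.picard g k t| ≤ M * (s * ((S.massMeasure (Icc 0 X)).toReal * X)) ^ k /
        k.factorial := fun k => by
      have h := S.abs_picard_le hX (f := g) (C := M) (fun u hu => by
        have := hM u hu; rwa [Real.norm_eq_abs] at this) k ht
      rw [abs_mul, abs_pow, abs_of_nonneg hs]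
      have hmt : 0 ≤ (S.massMeasure (Icc 0 X)).toReal * t := mul_nonneg ENNReal.toReal_nonneg ht.1
      calc s ^ k * |S.picard g k t|
          ≤ s ^ k * (M * ((S.massMeasure (Icc 0 X)).toReal * t) ^ k / k.factorial) :=
            mul_le_mul_of_nonneg_left h (pow_nonneg hs k)
        _ ≤ s ^ k * (M * ((S.massMeasure (Icc 0 X)).toReal * X) ^ k / k.factorial) := by
            refine mul_le_mul_of_nonneg_left (div_le_div_of_nonneg_right
              (mul_le_mul_of_nonneg_left (pow_le_pow_left₀ hmt
                (mul_le_mul_of_nonneg_left ht.2 ENNReal.toReal_nonneg) k) hM0) (by positivity))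
              (pow_nonneg hs k)
        _ = M * (s * ((S.massMeasure (Icc 0 X)).toReal * X)) ^ k / k.factorial := by
            rw [mul_pow]; ring
    have hlim : Tendsto (fun k : ℕ => M * (s * ((S.massMeasure (Icc 0 X)).toReal * X)) ^ k /
        k.factorial) atTop (𝓝 0) := by
      have := (Real.summable_pow_div_factorial
        (s * ((S.massMeasure (Icc 0 X)).toReal * X))).tendsto_atTop_zero.const_mul M
      rw [mul_zero] at this
      refine this.congr (fun k => ?_)
      ring
    exact squeeze_zero_norm (fun k => by rw [Real.norm_eq_abs]; exact hb k) hlim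
  have h3 := h1.add h2
  rw [add_zero] at h3
  exact ge_of_tendsto' h3 (fun k => hiter k t ht)

/-! ### Comparison of two strings -/

/-- **Comparison of `φ(·,-s)` for two strings**: on `[0, X]` (inside both strings),
`|φ_T - φ_S| ≤ A · φ_T(·,-s)` with
`A = s ∫₀ˣ ‖∫_{[0,u]} φ_S dm_T - ∫_{[0,u]} φ_S dm_S‖ du`. [cite: KotaniWatanabe1982, §2] -/
theorem norm_phi_neg_sub_le (T S : KreinString) {s : ℝ} (hs : 0 < s) {X : ℝ} (hX : X ∈ S.dom)
    (hXT : X ∈ T.dom) {t : ℝ} (ht : t ∈ Icc 0 X) :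
    ‖T.phi (-(s : ℂ)) t - S.phi (-(s : ℂ)) t‖ ≤
      (s * ∫ u in Icc 0 X, ‖(∫ v in Icc 0 u, S.phi (-(s : ℂ)) v ∂T.massMeasure) -
          (∫ v in Icc 0 u, S.phi (-(s : ℂ)) v ∂S.massMeasure)‖) * (T.phi (-(s : ℂ)) t).re := by
  set z : ℂ := -(s : ℂ) with hz
  set δ : ℝ → ℂ := fun t => T.phi z t - S.phi z t with hδ
  set E : ℝ → ℂ := fun u => (∫ v in Icc 0 u, S.phi z v ∂T.massMeasure) -
    (∫ v in Icc 0 u, S.phi z v ∂S.massMeasure) with hE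
  -- continuity and integrability facts
  have hφT : ContinuousOn (T.phi z) (Icc 0 X) := (T.isSolution_phi z).1.mono (T.Icc_subset_dom hXT)
  have hφS : ContinuousOn (S.phi z) (Icc 0 X) := (S.isSolution_phi z).1.mono (S.Icc_subset_dom hX)
  have hδc : ContinuousOn δ (Icc 0 X) := hφT.sub hφS
  have hδn : ContinuousOn (fun t => ‖δ t‖) (Icc 0 X) := hδc.norm
  have hμT : T.massMeasure (Icc 0 X) ≠ ⊤ := (T.massMeasure_Icc_lt_top hXT).ne
  have hμS : S.massMeasure (Icc 0 X) ≠ ⊤ := (S.massMeasure_Icc_lt_top hX).ne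
  have hΦT : IntegrableOn (fun u => ∫ v in Icc 0 u, T.phi z v ∂T.massMeasure) (Icc 0 X) :=
    integrableOn_integral_Icc hμT (T.integrableOn_Icc_of_continuousOn hXT hφT)
  have hΦS : IntegrableOn (fun u => ∫ v in Icc 0 u, S.phi z v ∂S.massMeasure) (Icc 0 X) :=
    integrableOn_integral_Icc hμS (S.integrableOn_Icc_of_continuousOn hX hφS)
  have hΦST : IntegrableOn (fun u => ∫ v in Icc 0 u, S.phi z v ∂T.massMeasure) (Icc 0 X) :=
    integrableOn_integral_Icc hμT (integrableOn_Icc_of_continuousOn_of_ne_top hμT hφS)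
  have hEi : IntegrableOn E (Icc 0 X) := hΦST.sub hΦS
  have hEn : IntegrableOn (fun u => ‖E u‖) (Icc 0 X) := hEi.norm
  -- the Volterra inequality `‖δ‖ ≤ A + s K_T ‖δ‖`
  have hvolt : ∀ t ∈ Icc 0 X,
      ‖δ t‖ ≤ (s * ∫ u in Icc 0 X, ‖E u‖) + s * T.picard (fun t => ‖δ t‖) 1 t := by
    intro t ht
    have htT : t ∈ T.dom := T.Icc_subset_dom hXT ht
    have htS : t ∈ S.dom := S.Icc_subset_dom hX ht
    have hsub : Icc 0 t ⊆ Icc 0 X := Icc_subset_Icc_right ht.2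
    -- `δ t = s ∫₀ᵗ (Φ_T u - Φ_S u) du`
    have h1 : δ t = -z * ∫ u in Icc 0 t, ((∫ v in Icc 0 u, T.phi z v ∂T.massMeasure) -
        (∫ v in Icc 0 u, S.phi z v ∂S.massMeasure)) := by
      simp only [hδ]
      rw [T.phi_eq_one_sub_integral z htT, S.phi_eq_one_sub_integral z htS,
        integral_sub (hΦT.mono_set hsub) (hΦS.mono_set hsub)]
      ring
    -- `Φ_T u - Φ_S u = ∫_{[0,u]} δ dm_T + E u`
    have h2 : ∀ u ∈ Icc 0 t, (∫ v in Icc 0 u, T.phi z v ∂T.massMeasure) -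
        (∫ v in Icc 0 u, S.phi z v ∂S.massMeasure) =
        (∫ v in Icc 0 u, δ v ∂T.massMeasure) + E u := by
      intro u hu
      have huT : u ∈ T.dom := T.Icc_subset_dom hXT (hsub hu)
      have hsub' : Icc 0 u ⊆ Icc 0 X := Icc_subset_Icc_right (hu.2.trans ht.2)
      simp only [hE, hδ]
      rw [integral_sub ((T.integrableOn_Icc_of_continuousOn hXT hφT).mono_set hsub')
        ((integrableOn_Icc_of_continuousOn_of_ne_top hμT hφS).mono_set hsub')]
      ring
    -- pointwise bound of the integrand
    have h3 : ∀ u ∈ Icc 0 t, ‖(∫ v in Icc 0 u, T.phi z v ∂T.massMeasure) -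
        (∫ v in Icc 0 u, S.phi z v ∂S.massMeasure)‖ ≤
        (∫ v in Icc 0 u, ‖δ v‖ ∂T.massMeasure) + ‖E u‖ := by
      intro u hu
      rw [h2 u hu]
      exact (norm_add_le _ _).trans (add_le_add (norm_integral_le_integral_norm _) le_rfl)
    -- integrability of the majorant
    have hmono : MonotoneOn (fun u => ∫ v in Icc 0 u, ‖δ v‖ ∂T.massMeasure) (Icc 0 X) := by
      intro u hu u' hu' huu'
      refine setIntegral_mono_set ?_ ?_ (ae_of_all _ (Icc_subset_Icc_right huu'))
      · exact (T.integrableOn_Icc_of_continuousOn hXT hδn).mono_set (Icc_subset_Icc_right hu'.2)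
      · exact ae_of_all _ (fun v => norm_nonneg _)
    have hmaj : IntegrableOn (fun u => (∫ v in Icc 0 u, ‖δ v‖ ∂T.massMeasure) + ‖E u‖) (Icc 0 t) :=
      ((hmono.integrableOn_isCompact isCompact_Icc).mono_set hsub).add (hEn.mono_set hsub)
    calc ‖δ t‖ = s * ‖∫ u in Icc 0 t, ((∫ v in Icc 0 u, T.phi z v ∂T.massMeasure) -
          (∫ v in Icc 0 u, S.phi z v ∂S.massMeasure))‖ := by
          rw [h1, norm_mul, hz, norm_neg, norm_neg, Complex.norm_real, Real.norm_eq_abs,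
            abs_of_pos hs]
      _ ≤ s * ∫ u in Icc 0 t, ((∫ v in Icc 0 u, ‖δ v‖ ∂T.massMeasure) + ‖E u‖) := by
          refine mul_le_mul_of_nonneg_left ?_ hs.le
          refine norm_integral_le_of_norm_le hmaj ?_
          rw [ae_restrict_iff' measurableSet_Icc]
          exact ae_of_all _ h3
      _ = s * T.picard (fun t => ‖δ t‖) 1 t + s * ∫ u in Icc 0 t, ‖E u‖ := by
          rw [integral_add ((hmono.integrableOn_isCompact isCompact_Icc).mono_set hsub)
            (hEn.mono_set hsub), T.picard_one_eq_integral_integral htT (hδn.mono hsub)]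
          ring
      _ ≤ s * T.picard (fun t => ‖δ t‖) 1 t + s * ∫ u in Icc 0 X, ‖E u‖ :=
          add_le_add le_rfl (mul_le_mul_of_nonneg_left (setIntegral_mono_set hEn
            (ae_of_all _ fun u => norm_nonneg _) (ae_of_all _ hsub)) hs.le)
      _ = (s * ∫ u in Icc 0 X, ‖E u‖) + s * T.picard (fun t => ‖δ t‖) 1 t := by ring
  exact T.le_mul_phi_of_le_add_picard hXT hδn hs.le hvolt t ht

/-- `‖φ(u,-s)‖ ≤ φ(X,-s)` for `0 ≤ u ≤ X < L`. [folklore] -/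
lemma norm_phi_neg_le_re {s : ℝ} (hs : 0 ≤ s) {X : ℝ} (hX : X ∈ S.dom) {u : ℝ}
    (hu : u ∈ Icc 0 X) : ‖S.phi (-(s : ℂ)) u‖ ≤ (S.phi (-(s : ℂ)) X).re := by
  have huD : u ∈ S.dom := S.Icc_subset_dom hX hu
  have h1 := S.norm_phi_le (-(s : ℂ)) huD
  rw [norm_neg, Complex.norm_real, Real.norm_eq_abs, abs_of_nonneg hs] at h1
  exact h1.trans (S.monotoneOn_phi_neg_re hs huD hX hu.2)

/-- The mass function is a.e.-strongly measurable on `[0, X] ⊆ [0, L)` (it is monotone there).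
[folklore] -/
lemma aestronglyMeasurable_mass {X : ℝ} (hX : X ∈ S.dom) :
    AEStronglyMeasurable S.mass (volume.restrict (Icc 0 X)) :=
  ((S.monotoneOn_mass.mono (S.Icc_subset_dom hX)).integrableOn_isCompact
    isCompact_Icc).aestronglyMeasurable

/-- **The error term of the comparison is controlled by `∫ |m_T - m_S|`**: for `u ∈ [0, X]`,
`‖∫_{[0,u]} φ_S dm_T - ∫_{[0,u]} φ_S dm_S‖ ≤ φ_S(X)|m_T(u) - m_S(u)| + s φ_S(X) m_S(X) D`,
`D = ∫₀ˣ|m_T - m_S|`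
(integration by parts). [cite: KotaniWatanabe1982, §2] -/
theorem norm_setIntegral_phi_sub_le (T S : KreinString) {s : ℝ} (hs : 0 < s) {X : ℝ}
    (hX : X ∈ S.dom) (hXT : X ∈ T.dom) {u : ℝ} (hu : u ∈ Icc 0 X) :
    ‖(∫ v in Icc 0 u, S.phi (-(s : ℂ)) v ∂T.massMeasure) -
        (∫ v in Icc 0 u, S.phi (-(s : ℂ)) v ∂S.massMeasure)‖ ≤
      (S.phi (-(s : ℂ)) X).re * |T.mass u - S.mass u| +
        s * ((S.phi (-(s : ℂ)) X).re * S.mass X) * ∫ v in Icc 0 X, |T.mass v - S.mass v| := by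
  set z : ℂ := -(s : ℂ) with hz
  have huS : u ∈ S.dom := S.Icc_subset_dom hX hu
  have huT : u ∈ T.dom := T.Icc_subset_dom hXT hu
  have hsub : Icc 0 u ⊆ Icc 0 X := Icc_subset_Icc_right hu.2
  have hμT : T.massMeasure (Icc 0 u) ≠ ⊤ := (T.massMeasure_Icc_lt_top huT).ne
  have hμS : S.massMeasure (Icc 0 u) ≠ ⊤ := (S.massMeasure_Icc_lt_top huS).ne
  set Φ : ℝ → ℂ := fun t => ∫ v in Icc 0 t, S.phi z v ∂S.massMeasure with hΦ
  set C := (S.phi z X).re with hC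
  have hC0 : 0 ≤ C := (norm_nonneg _).trans (S.norm_phi_neg_le_re hs.le hX hu)
  have hφS : ContinuousOn (S.phi z) (Icc 0 X) := (S.isSolution_phi z).1.mono (S.Icc_subset_dom hX)
  have hΦi : IntegrableOn Φ (Icc 0 X) :=
    integrableOn_integral_Icc (S.massMeasure_Icc_lt_top hX).ne
      (S.integrableOn_Icc_of_continuousOn hX hφS)
  have hΦb : ∀ t ∈ Icc 0 X, ‖Φ t‖ ≤ C * S.mass X := by
    intro t ht
    refine (norm_setIntegral_Icc_le (S.integrableOn_Icc_of_continuousOn hX hφS) ht).trans ?_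
    haveI := S.isFiniteMeasure_restrict_Icc hX
    calc ∫ v in Icc 0 X, ‖S.phi z v‖ ∂S.massMeasure ≤ ∫ _ in Icc 0 X, C ∂S.massMeasure := by
          refine integral_mono_of_nonneg (ae_of_all _ fun v => norm_nonneg _) (integrable_const C)
            ?_
          rw [EventuallyLE, ae_restrict_iff' measurableSet_Icc]
          exact ae_of_all _ (fun v hv => S.norm_phi_neg_le_re hs.le hX hv)
      _ = C * S.mass X := by
          rw [setIntegral_const, smul_eq_mul, measureReal_def, ← S.mass_eq_toReal_Icc, mul_comm]
  -- by parts against both measures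
  have hT' := S.setIntegral_phi_eq_parts z huS (ν := T.massMeasure) hμT
  have hS' := S.setIntegral_phi_eq_parts z huS (ν := S.massMeasure) hμS
  simp_rw [← T.mass_eq_toReal_Icc] at hT'
  simp_rw [← S.mass_eq_toReal_Icc] at hS'
  -- integrability of `Φ · m`
  have hmT : AEStronglyMeasurable (fun t => (T.mass t : ℂ)) (volume.restrict (Icc 0 u)) :=
    Complex.continuous_ofReal.comp_aestronglyMeasurable
      ((T.aestronglyMeasurable_mass hXT).mono_measure (Measure.restrict_mono hsub le_rfl))
  have hmS : AEStronglyMeasurable (fun t => (S.mass t : ℂ)) (volume.restrict (Icc 0 u)) :=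
    Complex.continuous_ofReal.comp_aestronglyMeasurable
      ((S.aestronglyMeasurable_mass hX).mono_measure (Measure.restrict_mono hsub le_rfl))
  have hbT : ∀ᵐ t ∂(volume.restrict (Icc 0 u)), ‖(T.mass t : ℂ)‖ ≤ T.mass X := by
    rw [ae_restrict_iff' measurableSet_Icc]
    refine ae_of_all _ (fun t ht => ?_)
    rw [Complex.norm_real, Real.norm_eq_abs, abs_of_nonneg (T.mass_nonneg t)]
    exact T.monotoneOn_mass (T.Icc_subset_dom hXT (hsub ht)) hXT (ht.2.trans hu.2)
  have hbS : ∀ᵐ t ∂(volume.restrict (Icc 0 u)), ‖(S.mass t : ℂ)‖ ≤ S.mass X := by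
    rw [ae_restrict_iff' measurableSet_Icc]
    refine ae_of_all _ (fun t ht => ?_)
    rw [Complex.norm_real, Real.norm_eq_abs, abs_of_nonneg (S.mass_nonneg t)]
    exact S.monotoneOn_mass (S.Icc_subset_dom hX (hsub ht)) hX (ht.2.trans hu.2)
  have hiT : IntegrableOn (fun t => Φ t * (T.mass t : ℂ)) (Icc 0 u) := by
    have := (hΦi.mono_set hsub).bdd_mul hmT hbT
    exact this.congr (ae_of_all _ fun t => by ring)
  have hiS : IntegrableOn (fun t => Φ t * (S.mass t : ℂ)) (Icc 0 u) := by
    have := (hΦi.mono_set hsub).bdd_mul hmS hbS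
    exact this.congr (ae_of_all _ fun t => by ring)
  have hΔi : IntegrableOn (fun t => |T.mass t - S.mass t|) (Icc 0 X) := by
    have h := (((T.monotoneOn_mass.mono (T.Icc_subset_dom hXT)).integrableOn_isCompact
      isCompact_Icc (μ := volume)).sub
      ((S.monotoneOn_mass.mono (S.Icc_subset_dom hX)).integrableOn_isCompact
      isCompact_Icc (μ := volume))).norm
    exact h.congr (ae_of_all _ fun t => by simp [Real.norm_eq_abs])
  -- the difference
  have hdiff : (∫ v in Icc 0 u, S.phi z v ∂T.massMeasure) -
      (∫ v in Icc 0 u, S.phi z v ∂S.massMeasure) =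
      S.phi z u * ((T.mass u - S.mass u : ℝ) : ℂ) -
        (-z) * ∫ t in Icc 0 u, Φ t * ((T.mass t - S.mass t : ℝ) : ℂ) := by
    rw [hT', hS']
    have : ∫ t in Icc 0 u, Φ t * ((T.mass t - S.mass t : ℝ) : ℂ) =
        (∫ t in Icc 0 u, Φ t * (T.mass t : ℂ)) - ∫ t in Icc 0 u, Φ t * (S.mass t : ℂ) := by
      rw [← integral_sub hiT hiS]
      refine integral_congr_ae (ae_of_all _ fun t => ?_)
      push_cast
      ring
    rw [this]
    push_cast
    ring
  rw [hdiff]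
  have hzn : ‖-z‖ = s := by
    rw [hz, neg_neg, Complex.norm_real, Real.norm_eq_abs, abs_of_pos hs]
  calc ‖S.phi z u * ((T.mass u - S.mass u : ℝ) : ℂ) -
        (-z) * ∫ t in Icc 0 u, Φ t * ((T.mass t - S.mass t : ℝ) : ℂ)‖
      ≤ ‖S.phi z u‖ * |T.mass u - S.mass u| +
          s * ‖∫ t in Icc 0 u, Φ t * ((T.mass t - S.mass t : ℝ) : ℂ)‖ := by
        refine (norm_sub_le _ _).trans (le_of_eq ?_)
        rw [norm_mul, norm_mul, Complex.norm_real, Real.norm_eq_abs, hzn]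
    _ ≤ C * |T.mass u - S.mass u| +
          s * ∫ t in Icc 0 u, C * S.mass X * |T.mass t - S.mass t| := by
        gcongr
        · exact S.norm_phi_neg_le_re hs.le hX hu
        · refine norm_integral_le_of_norm_le ((hΔi.mono_set hsub).const_mul _) ?_
          · rw [ae_restrict_iff' measurableSet_Icc]
            refine ae_of_all _ (fun t ht => ?_)
            rw [norm_mul, Complex.norm_real, Real.norm_eq_abs]
            exact mul_le_mul_of_nonneg_right (hΦb t (hsub ht)) (abs_nonneg _)
    _ ≤ C * |T.mass u - S.mass u| + s * (C * S.mass X) * ∫ v in Icc 0 X, |T.mass v - S.mass v| := by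
        rw [integral_const_mul, ← mul_assoc]
        refine add_le_add le_rfl (mul_le_mul_of_nonneg_left ?_ ?_)
        · exact setIntegral_mono_set hΔi (ae_of_all _ fun t => abs_nonneg _) (ae_of_all _ hsub)
        · exact mul_nonneg hs.le (mul_nonneg hC0 (S.mass_nonneg X))

end KreinString

/-! ### The stability theorem -/

/-- **Stability of `φ(·,-s)`** (interior step of the continuity theorem for strings): if
`X ∈ [0, L)` eventually lies in the strings `T_n`, `m_{T_n} → m_S` a.e. on `[0, X]` and at `X`,
then `φ_{T_n}(·,-s) → φ_S(·,-s)` uniformly on `[0, X]`. [cite: KotaniWatanabe1982, §2] -/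
theorem tendsto_phi_neg_uniformly (T : ℕ → KreinString) (S : KreinString) {s : ℝ} (hs : 0 < s)
    {X : ℝ} (hX : X ∈ S.dom) (hXT : ∀ᶠ n in atTop, X ∈ (T n).dom)
    (hae : ∀ᵐ t ∂(volume.restrict (Icc 0 X)),
      Tendsto (fun n => (T n).mass t) atTop (𝓝 (S.mass t)))
    (hXc : Tendsto (fun n => (T n).mass X) atTop (𝓝 (S.mass X))) :
    ∀ ε > 0, ∀ᶠ n in atTop, ∀ t ∈ Icc 0 X,
      ‖(T n).phi (-(s : ℂ)) t - S.phi (-(s : ℂ)) t‖ ≤ ε := by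
  haveI : IsFiniteMeasure ((volume : Measure ℝ).restrict (Icc 0 X)) :=
    isFiniteMeasure_restrict.2 measure_Icc_lt_top.ne
  set C := (S.phi (-(s : ℂ)) X).re with hC
  have hC0 : 0 ≤ C := (norm_nonneg _).trans (S.norm_phi_neg_le_re hs.le hX ⟨hX.1, le_rfl⟩)
  -- `D_n = ∫₀ˣ |m_n - m| → 0` by dominated convergence
  have hmb : ∀ᶠ n in atTop, (T n).mass X ≤ S.mass X + 1 :=
    hXc.eventually (Iic_mem_nhds (by linarith))
  have hD : Tendsto (fun n => ∫ t in Icc 0 X, |(T n).mass t - S.mass t|) atTop (𝓝 0) := by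
    have h := tendsto_integral_filter_of_dominated_convergence
      (μ := (volume : Measure ℝ).restrict (Icc 0 X)) (l := atTop)
      (F := fun n t => |(T n).mass t - S.mass t|) (f := fun _ => (0 : ℝ))
      (fun _ => S.mass X + 1 + S.mass X) ?_ ?_ (integrable_const _) ?_
    · simpa using h
    · filter_upwards [hXT] with n hn
      exact (((T n).aestronglyMeasurable_mass hn).sub (S.aestronglyMeasurable_mass hX)).norm.congr
        (ae_of_all _ fun t => by simp [Real.norm_eq_abs])
    · filter_upwards [hXT, hmb] with n hn hnb
      rw [ae_restrict_iff' measurableSet_Icc]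
      refine ae_of_all _ (fun t ht => ?_)
      rw [Real.norm_eq_abs, abs_abs]
      have h1 : (T n).mass t ≤ (T n).mass X :=
        (T n).monotoneOn_mass ((T n).Icc_subset_dom hn ht) hn ht.2
      have h2 : S.mass t ≤ S.mass X := S.monotoneOn_mass (S.Icc_subset_dom hX ht) hX ht.2
      have h3 := (T n).mass_nonneg t
      have h4 := S.mass_nonneg t
      rw [abs_le]
      constructor <;> linarith
    · filter_upwards [hae] with t ht
      have := (ht.sub_const (S.mass t)).abs
      simpa using this
  -- the Grönwall constants `A_n = s (C D_n + s C m(X) X D_n)` tend to `0`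
  set A : ℕ → ℝ := fun n => s * ∫ u in Icc 0 X,
      ‖(∫ v in Icc 0 u, S.phi (-(s : ℂ)) v ∂(T n).massMeasure) -
      (∫ v in Icc 0 u, S.phi (-(s : ℂ)) v ∂S.massMeasure)‖ with hA
  have hAle : ∀ᶠ n in atTop, A n ≤ s * ((C + s * (C * S.mass X) * X) *
      ∫ t in Icc 0 X, |(T n).mass t - S.mass t|) := by
    filter_upwards [hXT] with n hn
    simp only [hA]
    refine mul_le_mul_of_nonneg_left ?_ hs.le
    have hΔi : IntegrableOn (fun t => |(T n).mass t - S.mass t|) (Icc 0 X) := by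
      have h := ((((T n).monotoneOn_mass.mono ((T n).Icc_subset_dom hn)).integrableOn_isCompact
        isCompact_Icc (μ := volume)).sub
        ((S.monotoneOn_mass.mono (S.Icc_subset_dom hX)).integrableOn_isCompact
        isCompact_Icc (μ := volume))).norm
      exact h.congr (ae_of_all _ fun t => by simp [Real.norm_eq_abs])
    calc ∫ u in Icc 0 X, ‖(∫ v in Icc 0 u, S.phi (-(s : ℂ)) v ∂(T n).massMeasure) -
          (∫ v in Icc 0 u, S.phi (-(s : ℂ)) v ∂S.massMeasure)‖
        ≤ ∫ u in Icc 0 X, (C * |(T n).mass u - S.mass u| +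
            s * (C * S.mass X) * ∫ v in Icc 0 X, |(T n).mass v - S.mass v|) := by
          refine integral_mono_of_nonneg (ae_of_all _ fun u => norm_nonneg _)
            ((hΔi.const_mul C).add (integrable_const _)) ?_
          rw [EventuallyLE, ae_restrict_iff' measurableSet_Icc]
          exact ae_of_all _ (fun u hu =>
            KreinString.norm_setIntegral_phi_sub_le (T n) S hs hX hn hu)
      _ = (C + s * (C * S.mass X) * X) * ∫ t in Icc 0 X, |(T n).mass t - S.mass t| := by
          rw [integral_add (hΔi.const_mul C) (integrable_const _), integral_const_mul,
            setIntegral_const, smul_eq_mul, Real.volume_real_Icc_of_le hX.1, sub_zero]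
          ring
  have hA0 : ∀ n, 0 ≤ A n := fun n => mul_nonneg hs.le (integral_nonneg fun u => norm_nonneg _)
  have hAt : Tendsto A atTop (𝓝 0) := by
    have hup : Tendsto (fun n => s * ((C + s * (C * S.mass X) * X) *
        ∫ t in Icc 0 X, |(T n).mass t - S.mass t|)) atTop (𝓝 0) := by
      have := (hD.const_mul (C + s * (C * S.mass X) * X)).const_mul s
      simpa using this
    refine squeeze_zero' (Eventually.of_forall hA0) hAle hup
  -- conclusion: `‖δ_n(t)‖ ≤ A_n φ_n(t) ≤ A_n exp(s (m(X)+1) X)`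
  intro ε hε
  have hexp : 0 < Real.exp (s * ((S.mass X + 1) * X)) := Real.exp_pos _
  have hsmallA : ∀ᶠ n in atTop, A n ≤ ε / Real.exp (s * ((S.mass X + 1) * X)) :=
    hAt.eventually (Iic_mem_nhds (by positivity))
  filter_upwards [hXT, hmb, hsmallA] with n hn hnb hnA t ht
  have h1 := KreinString.norm_phi_neg_sub_le (T n) S hs hX hn ht
  have h2 : ((T n).phi (-(s : ℂ)) t).re ≤ Real.exp (s * ((S.mass X + 1) * X)) := by
    refine ((T n).phi_neg_re_le_exp hs.le hn ht).trans ?_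
    gcongr
    · exact hX.1
  calc ‖(T n).phi (-(s : ℂ)) t - S.phi (-(s : ℂ)) t‖ ≤ A n * ((T n).phi (-(s : ℂ)) t).re := h1
    _ ≤ (ε / Real.exp (s * ((S.mass X + 1) * X))) * Real.exp (s * ((S.mass X + 1) * X)) :=
        mul_le_mul hnA h2 (zero_le_one.trans ((T n).one_le_phi_neg_re hs.le
          ((T n).Icc_subset_dom hn ht))) (by positivity)
    _ = ε := div_mul_cancel₀ ε hexp.ne'

namespace KreinString

end KreinString


/-- `∫ₓʸ (1 + c(t-a))⁻² dt ≤ (c(1 + c(x-a)))⁻¹` for `c > 0`, `a ≤ x ≤ y`. [folklore] -/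
lemma integral_inv_one_add_mul_sq_le_of_le {c a x y : ℝ} (hc : 0 < c) (hax : a ≤ x) (hxy : x ≤ y) :
    ∫ t in x..y, ((1 + c * (t - a)) ^ 2)⁻¹ ≤ (c * (1 + c * (x - a)))⁻¹ := by
  have hpos : ∀ t ∈ Icc x y, 0 < 1 + c * (t - a) := fun t ht => by nlinarith [ht.1]
  have hderiv : ∀ t ∈ uIcc x y,
      HasDerivAt (fun t => -(c * (1 + c * (t - a)))⁻¹) (((1 + c * (t - a)) ^ 2)⁻¹) t := by
    intro t ht
    rw [uIcc_of_le hxy] at ht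
    have h0 : c * (1 + c * (t - a)) ≠ 0 := mul_ne_zero hc.ne' (hpos t ht).ne'
    have h1 : HasDerivAt (fun t => c * (1 + c * (t - a))) (c * (c * 1)) t :=
      ((((hasDerivAt_id t).sub_const a).const_mul c).const_add 1).const_mul c
    refine ((h1.inv h0).neg).congr_deriv ?_
    field_simp
  have hcont : ContinuousOn (fun t => ((1 + c * (t - a)) ^ 2)⁻¹) (Icc x y) :=
    ((continuousOn_const.add (continuousOn_const.mul (continuousOn_id.sub continuousOn_const))).pow
      2).inv₀ (fun t ht => (pow_pos (hpos t ht) 2).ne')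
  rw [intervalIntegral.integral_eq_sub_of_hasDerivAt hderiv (hcont.intervalIntegrable_of_Icc hxy)]
  have hy1 : 0 < 1 + c * (y - a) := hpos y ⟨hxy, le_rfl⟩
  have : 0 ≤ (c * (1 + c * (y - a)))⁻¹ := by positivity
  linarith

namespace KreinString

variable (S : KreinString)

/-- Additivity of the Weyl quotient at `z = -s`: `ψ/φ(y) = ψ/φ(x) + ∫ₓʸ φ⁻²`. [folklore] -/
lemma psi_div_phi_neg_re_eq_add {s : ℝ} (hs : 0 ≤ s) {x y : ℝ} (hx : 0 ≤ x) (hxy : x ≤ y)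
    (hy : y ∈ S.dom) :
    (S.psi (-(s : ℂ)) y / S.phi (-(s : ℂ)) y).re =
      (S.psi (-(s : ℂ)) x / S.phi (-(s : ℂ)) x).re +
        ∫ t in x..y, ((S.phi (-(s : ℂ)) t).re ^ 2)⁻¹ := by
  have hxd : x ∈ S.dom := ⟨hx, (ENNReal.ofReal_le_ofReal hxy).trans_lt hy.2⟩
  have hint : IntervalIntegrable (fun t => ((S.phi (-(s : ℂ)) t).re ^ 2)⁻¹) volume 0 y :=
    (S.continuousOn_inv_phi_neg_re_sq s hs hy).intervalIntegrable_of_Icc hy.1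
  rw [S.psi_div_phi_neg_re hs hy, S.psi_div_phi_neg_re hs hxd,
    ← intervalIntegral.integral_add_adjacent_intervals
      (hint.mono_set (by rw [uIcc_of_le hx, uIcc_of_le hy.1]; exact Icc_subset_Icc_right hxy))
      (hint.mono_set (by rw [uIcc_of_le hxy, uIcc_of_le hy.1]; exact Icc_subset_Icc_left hx))]

/-- **Tail bound from mass at `a`**: for `a ≤ x ≤ y < L` with `m(a) > 0`,
`∫ₓʸ φ(t,-s)⁻² dt ≤ (s m(a) (1 + s m(a)(x-a)))⁻¹`. [cite: KotaniWatanabe1982, §2] -/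
lemma integral_inv_phi_sq_le_of_mass {s : ℝ} (hs : 0 < s) {a x y : ℝ} (ha : 0 ≤ a)
    (hma : 0 < S.mass a) (hax : a ≤ x) (hxy : x ≤ y) (hy : y ∈ S.dom) :
    ∫ t in x..y, ((S.phi (-(s : ℂ)) t).re ^ 2)⁻¹ ≤
      (s * S.mass a * (1 + s * S.mass a * (x - a)))⁻¹ := by
  have hc : 0 < s * S.mass a := mul_pos hs hma
  refine le_trans ?_ (integral_inv_one_add_mul_sq_le_of_le hc hax hxy)
  have hint : IntervalIntegrable (fun t => ((S.phi (-(s : ℂ)) t).re ^ 2)⁻¹) volume 0 y :=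
    (S.continuousOn_inv_phi_neg_re_sq s hs.le hy).intervalIntegrable_of_Icc hy.1
  refine intervalIntegral.integral_mono_on hxy
    (hint.mono_set (by
      rw [uIcc_of_le hxy, uIcc_of_le hy.1]; exact Icc_subset_Icc_left (ha.trans hax)))
    ?_ (fun t ht => ?_)
  · refine ContinuousOn.intervalIntegrable_of_Icc hxy ?_
    refine ((continuousOn_const.add (continuousOn_const.mul
      (continuousOn_id.sub continuousOn_const))).pow 2).inv₀ (fun t ht => ?_)
    have : 0 < 1 + s * S.mass a * (t - a) := by nlinarith [ht.1]
    exact (pow_pos this 2).ne'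
  · have htd : t ∈ S.dom := S.Icc_subset_dom hy ⟨ha.trans (hax.trans ht.1), ht.2⟩
    have hlow := S.phi_neg_re_ge hs.le ha (hax.trans ht.1) htd
    have hpos : 0 < 1 + s * S.mass a * (t - a) := by nlinarith [ht.1]
    have hle : 1 + s * S.mass a * (t - a) ≤ (S.phi (-(s : ℂ)) t).re := by nlinarith [hlow]
    gcongr

/-- **`q(-s) ≤ ψ/φ(x) + B`** when all tails `∫ₓʸ φ⁻²` (`x ≤ y < L`) are `≤ B`.
[cite: KacKrein1974, §2] -/
theorem weyl_neg_re_le_add (hS : ¬ S.IsTrivial) {s : ℝ} (hs : 0 < s) {x : ℝ} (hx : x ∈ S.dom)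
    {B : ℝ} (hB : ∀ y ∈ S.dom, x ≤ y → ∫ t in x..y, ((S.phi (-(s : ℂ)) t).re ^ 2)⁻¹ ≤ B) :
    (S.principalWeylFunction (-(s : ℂ))).re ≤ (S.psi (-(s : ℂ)) x / S.phi (-(s : ℂ)) x).re + B := by
  haveI := S.toEnd_neBot
  obtain ⟨ht, -, -⟩ := S.tendsto_principalWeylFunction_of_neg hS (z := -(s : ℂ)) (by simp)
    (by simpa using hs)
  refine le_of_tendsto ((Complex.continuous_re.tendsto _).comp ht) ?_
  filter_upwards [S.eventually_mem_dom_ge hx] with y hy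
  show (S.psi (-(s : ℂ)) y / S.phi (-(s : ℂ)) y).re ≤ _
  rw [S.psi_div_phi_neg_re_eq_add hs.le hx.1 hy.2 hy.1]
  exact add_le_add le_rfl (hB y hy.1 hy.2)

/-- **The Weyl quotient depends continuously on `φ`**: if `|φ_T - φ_S| ≤ η` on `[0, x]`, then
`|ψ_T/φ_T(x) - ψ_S/φ_S(x)| ≤ 2 x η` (both `φ ≥ 1`). [folklore] -/
lemma abs_psi_div_phi_sub_le (T S : KreinString) {s : ℝ} (hs : 0 ≤ s) {x : ℝ} (hxS : x ∈ S.dom)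
    (hxT : x ∈ T.dom) {η : ℝ} (hη : ∀ t ∈ Icc 0 x, ‖T.phi (-(s : ℂ)) t - S.phi (-(s : ℂ)) t‖ ≤ η) :
    |(T.psi (-(s : ℂ)) x / T.phi (-(s : ℂ)) x).re - (S.psi (-(s : ℂ)) x / S.phi (-(s : ℂ)) x).re| ≤
      2 * x * η := by
  rw [T.psi_div_phi_neg_re hs hxT, S.psi_div_phi_neg_re hs hxS,
    ← intervalIntegral.integral_sub
      ((T.continuousOn_inv_phi_neg_re_sq s hs hxT).intervalIntegrable_of_Icc hxT.1)
      ((S.continuousOn_inv_phi_neg_re_sq s hs hxS).intervalIntegrable_of_Icc hxS.1)]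
  have hb : ∀ t ∈ Icc 0 x, |((T.phi (-(s : ℂ)) t).re ^ 2)⁻¹ - ((S.phi (-(s : ℂ)) t).re ^ 2)⁻¹| ≤
      2 * η := by
    intro t ht
    set a := (T.phi (-(s : ℂ)) t).re with ha
    set b := (S.phi (-(s : ℂ)) t).re with hb
    have ha1 : 1 ≤ a := T.one_le_phi_neg_re hs (T.Icc_subset_dom hxT ht)
    have hb1 : 1 ≤ b := S.one_le_phi_neg_re hs (S.Icc_subset_dom hxS ht)
    have hab : |a - b| ≤ η := by
      have h := hη t ht
      have : (T.phi (-(s : ℂ)) t - S.phi (-(s : ℂ)) t).re = a - b := by simp [ha, hb]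
      rw [← this]
      exact (Complex.abs_re_le_norm _).trans h
    have hkey : (a ^ 2)⁻¹ - (b ^ 2)⁻¹ = (b - a) * ((a + b) / (a ^ 2 * b ^ 2)) := by
      field_simp
      ring
    rw [hkey, abs_mul, abs_sub_comm]
    have hfrac : |(a + b) / (a ^ 2 * b ^ 2)| ≤ 2 := by
      rw [abs_of_nonneg (by positivity), div_le_iff₀ (by positivity)]
      nlinarith [mul_le_mul ha1 hb1 zero_le_one (by linarith),
        mul_le_mul ha1 ha1 zero_le_one (by linarith),
        mul_le_mul hb1 hb1 zero_le_one (by linarith),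
        mul_nonneg (by linarith : (0:ℝ) ≤ a) (by linarith : (0:ℝ) ≤ b)]
    calc |a - b| * |(a + b) / (a ^ 2 * b ^ 2)| ≤ η * 2 :=
          mul_le_mul hab hfrac (abs_nonneg _) ((abs_nonneg _).trans hab)
      _ = 2 * η := by ring
  have h := intervalIntegral.norm_integral_le_of_norm_le_const (a := 0) (b := x) (C := 2 * η)
    (f := fun t => ((T.phi (-(s : ℂ)) t).re ^ 2)⁻¹ - ((S.phi (-(s : ℂ)) t).re ^ 2)⁻¹)
    (fun t ht => by
      rw [uIoc_of_le hxS.1] at ht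
      rw [Real.norm_eq_abs]
      exact hb t ⟨ht.1.le, ht.2⟩)
  rw [Real.norm_eq_abs, sub_zero, abs_of_nonneg hxS.1] at h
  linarith

/-! ### The continuity theorem -/

section Continuity

variable {T : ℕ → KreinString} {S : KreinString}

/-- Points of `[0, L)` at which the masses converge are dense: above every `a ∈ [0, L)` there is
one (a full-measure set meets every interval). [folklore] -/
lemma exists_good_ge
    (hconv : ∀ᵐ x : ℝ, x ∈ S.dom → ((∀ᶠ n in atTop, x ∈ (T n).dom) ∧
      Tendsto (fun n => (T n).mass x) atTop (𝓝 (S.mass x))))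
    {a : ℝ} (ha : a ∈ S.dom) :
    ∃ X ∈ S.dom, a ≤ X ∧ (∀ᶠ n in atTop, X ∈ (T n).dom) ∧
      Tendsto (fun n => (T n).mass X) atTop (𝓝 (S.mass X)) := by
  obtain ⟨a', ha', haa'⟩ := S.exists_mem_dom_gt ha
  by_contra hcon
  push Not at hcon
  have hsub : Ioo a a' ⊆ {x | ¬ (x ∈ S.dom → ((∀ᶠ n in atTop, x ∈ (T n).dom) ∧
      Tendsto (fun n => (T n).mass x) atTop (𝓝 (S.mass x))))} := by
    intro x hx
    have hxd : x ∈ S.dom := ⟨ha.1.trans hx.1.le, (ENNReal.ofReal_le_ofReal hx.2.le).trans_lt ha'.2⟩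
    simp only [mem_setOf_eq]
    intro himp
    obtain ⟨h1, h2⟩ := himp hxd
    exact hcon x hxd hx.1.le h1 h2
  have h0 : volume (Ioo a a') = 0 := measure_mono_null hsub (ae_iff.1 hconv)
  rw [Real.volume_Ioo] at h0
  have : ENNReal.ofReal (a' - a) ≠ 0 := (ENNReal.ofReal_pos.2 (by linarith)).ne'
  exact this h0

/-- From a uniform eventual tail bound beyond a point `X` to a bound for `q_{T_n}(-s)`.
[folklore] -/
lemma weyl_le_of_tails (hT : ∀ n, ¬ (T n).IsTrivial) {s : ℝ} (hs : 0 < s) {X ε : ℝ}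
    (h : ∀ᶠ n in atTop, X ∈ (T n).dom ∧ ∀ y ∈ (T n).dom, X ≤ y →
      ∫ t in X..y, (((T n).phi (-(s : ℂ)) t).re ^ 2)⁻¹ ≤ ε) :
    ∀ᶠ n in atTop, X ∈ (T n).dom ∧ ((T n).principalWeylFunction (-(s : ℂ))).re ≤
      ((T n).psi (-(s : ℂ)) X / (T n).phi (-(s : ℂ)) X).re + ε := by
  filter_upwards [h] with n hn
  exact ⟨hn.1, (T n).weyl_neg_re_le_add (hT n) hs hn.1 hn.2⟩

/-- **Uniform tail control** (the three cases: long string, heavy end, regular end): for every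
`ε > 0` there is a good point `X ∈ [0, L)` beyond which the tails of all but finitely many `T_n`
are `≤ ε`. [cite: KotaniWatanabe1982, §2] -/
lemma exists_good_tail_le (hS : ¬ S.IsTrivial) (hT : ∀ n, ¬ (T n).IsTrivial) {s : ℝ} (hs : 0 < s)
    (hconv : ∀ᵐ x : ℝ, x ∈ S.dom → ((∀ᶠ n in atTop, x ∈ (T n).dom) ∧
      Tendsto (fun n => (T n).mass x) atTop (𝓝 (S.mass x))))
    (hexpl : ∀ x : ℝ, S.length < ENNReal.ofReal x → ∀ K : ℝ,
      ∀ᶠ n in atTop, x ∉ (T n).dom ∨ K ≤ (T n).mass x) {ε : ℝ} (hε : 0 < ε) :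
    ∃ X ∈ S.dom, (∀ᶠ n in atTop, X ∈ (T n).dom) ∧
      Tendsto (fun n => (T n).mass X) atTop (𝓝 (S.mass X)) ∧
      ∀ᶠ n in atTop, X ∈ (T n).dom ∧ ((T n).principalWeylFunction (-(s : ℂ))).re ≤
        ((T n).psi (-(s : ℂ)) X / (T n).phi (-(s : ℂ)) X).re + ε := by
  by_cases hL : S.length = ⊤
  · -- Case 1: `L = ∞`; use a point `a` carrying mass and go far beyond it
    obtain ⟨k, hk⟩ := S.exists_mass_pos hL hS
    have hkd : (k : ℝ) ∈ S.dom := ⟨k.cast_nonneg, by simp [hL]⟩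
    obtain ⟨a, ha, hka, haT, hac⟩ := exists_good_ge hconv hkd
    have hma : 0 < S.mass a := hk.trans_le (S.monotoneOn_mass hkd ha hka)
    set m := S.mass a with hm
    set R : ℝ := 8 / (s ^ 2 * m ^ 2 * ε) with hR
    have hR0 : 0 ≤ R := by positivity
    have hXd : a + R ∈ S.dom := ⟨by linarith [ha.1], by simp [hL]⟩
    obtain ⟨X, hX, haX, hXT, hXc⟩ := exists_good_ge hconv hXd
    refine ⟨X, hX, hXT, hXc, weyl_le_of_tails hT hs ?_⟩
    have hmn : ∀ᶠ n in atTop, m / 2 ≤ (T n).mass a :=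
      hac.eventually (Ici_mem_nhds (by rw [hm]; linarith))
    filter_upwards [haT, hmn, hXT] with n hna hnm hnX
    refine ⟨hnX, fun y hy hXy => ?_⟩
    have hmn0 : 0 < (T n).mass a := by linarith
    refine ((T n).integral_inv_phi_sq_le_of_mass hs ha.1 hmn0 (by linarith) hXy hy).trans ?_
    -- `(s mₙ(a)(1 + s mₙ(a)(X-a)))⁻¹ ≤ (s (m/2) (s (m/2) R))⁻¹ = ε/2 ≤ ε`
    have h1 : s * (m / 2) * (s * (m / 2) * R) ≤
        s * (T n).mass a * (1 + s * (T n).mass a * (X - a)) := by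
      have hXa : R ≤ X - a := by linarith
      have h2 : s * (m / 2) ≤ s * (T n).mass a := mul_le_mul_of_nonneg_left hnm hs.le
      have h3 : s * (m / 2) * R ≤ 1 + s * (T n).mass a * (X - a) := by
        nlinarith [mul_nonneg (mul_nonneg hs.le (by linarith : (0:ℝ) ≤ m / 2)) hR0,
          mul_le_mul h2 hXa hR0 (by positivity)]
      exact mul_le_mul h2 h3 (by positivity) (by positivity)
    have h0 : 0 < s * (m / 2) * (s * (m / 2) * R) := by positivity
    calc (s * (T n).mass a * (1 + s * (T n).mass a * (X - a)))⁻¹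
        ≤ (s * (m / 2) * (s * (m / 2) * R))⁻¹ :=
          inv_anti₀ h0 h1
      _ = ε / 2 := by rw [hR]; field_simp; ring
      _ ≤ ε := by linarith
  · by_cases hbdd : ∃ M : ℝ, ∀ a ∈ S.dom, S.mass a ≤ M
    · -- Case 3: regular end: `L < ∞`, bounded mass
      have hℓ : 0 < S.length.toReal := ENNReal.toReal_pos S.length_pos.ne' hL
      set ℓ := S.length.toReal with hℓdef
      have hLeq : S.length = ENNReal.ofReal ℓ := (ENNReal.ofReal_toReal hL).symm
      set a₀ := max 0 (ℓ - ε / 4) with ha₀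
      have ha₀d : a₀ ∈ S.dom := by
        refine ⟨le_max_left _ _, ?_⟩
        rw [hLeq, ENNReal.ofReal_lt_ofReal_iff hℓ]
        exact max_lt hℓ (by linarith)
      obtain ⟨X, hX, ha₀X, hXT, hXc⟩ := exists_good_ge hconv ha₀d
      have hXℓ : X < ℓ := by
        have := hX.2; rw [hLeq, ENNReal.ofReal_lt_ofReal_iff hℓ] at this; exact this
      set K : ℝ := 4 / (s * ε) with hK
      have hK0 : 0 < K := by positivity
      have hsK : (s * K)⁻¹ = ε / 4 := by rw [hK]; field_simp
      set x' := ℓ + ε / 8 with hx'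
      have hx'L : S.length < ENNReal.ofReal x' := by
        rw [hLeq, ENNReal.ofReal_lt_ofReal_iff (by positivity)]; linarith
      refine ⟨X, hX, hXT, hXc, weyl_le_of_tails hT hs ?_⟩
      filter_upwards [hexpl x' hx'L K, hXT] with n hn hnX
      refine ⟨hnX, fun y hy hXy => ?_⟩
      set c := min y (ℓ + ε / 4) with hc
      have hXc' : X ≤ c := le_min hXy (by linarith)
      have hcy : c ≤ y := min_le_left _ _
      have hcd : c ∈ (T n).dom := ⟨hX.1.trans hXc', (ENNReal.ofReal_le_ofReal hcy).trans_lt hy.2⟩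
      have hint : IntervalIntegrable (fun t => (((T n).phi (-(s : ℂ)) t).re ^ 2)⁻¹) volume 0 y :=
        ((T n).continuousOn_inv_phi_neg_re_sq s hs.le hy).intervalIntegrable_of_Icc hy.1
      rw [← intervalIntegral.integral_add_adjacent_intervals
        (hint.mono_set (by rw [uIcc_of_le hXc', uIcc_of_le hy.1]; exact Icc_subset_Icc hX.1 hcy))
        (hint.mono_set (by
          rw [uIcc_of_le hcy, uIcc_of_le hy.1]; exact Icc_subset_Icc_left (hX.1.trans hXc')))]
      -- first piece: short interval, `φ ≥ 1`
      have h1 : ∫ t in X..c, (((T n).phi (-(s : ℂ)) t).re ^ 2)⁻¹ ≤ ε / 2 := by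
        calc ∫ t in X..c, (((T n).phi (-(s : ℂ)) t).re ^ 2)⁻¹ ≤ ∫ _ in X..c, (1 : ℝ) :=
              intervalIntegral.integral_mono_on hXc'
                (hint.mono_set (by
                  rw [uIcc_of_le hXc', uIcc_of_le hy.1]; exact Icc_subset_Icc hX.1 hcy))
                intervalIntegrable_const (fun t ht => inv_le_one_of_one_le₀ (one_le_pow₀
                  ((T n).one_le_phi_neg_re hs.le
                    ((T n).Icc_subset_dom hcd ⟨hX.1.trans ht.1, ht.2⟩))))
          _ = c - X := by simp
          _ ≤ ε / 2 := by
              have : c ≤ ℓ + ε / 4 := min_le_right _ _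
              have : ℓ - ε / 4 ≤ X := (le_max_right _ _).trans ha₀X
              linarith
      -- second piece: empty, or controlled by the exploding mass at `x'`
      have h2 : ∫ t in c..y, (((T n).phi (-(s : ℂ)) t).re ^ 2)⁻¹ ≤ ε / 4 := by
        by_cases hyℓ : y ≤ ℓ + ε / 4
        · have : c = y := min_eq_left hyℓ
          rw [this, intervalIntegral.integral_same]
          positivity
        · have hcy' : c = ℓ + ε / 4 := min_eq_right (le_of_lt (not_le.1 hyℓ))
          have hx'c : x' ≤ c := by rw [hcy', hx']; linarith
          have hx'd : x' ∈ (T n).dom :=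
            ⟨by positivity, (ENNReal.ofReal_le_ofReal (hx'c.trans hcy)).trans_lt hy.2⟩
          have hKm : K ≤ (T n).mass x' := by
            rcases hn with h | h
            · exact absurd hx'd h
            · exact h
          have hm0 : 0 < (T n).mass x' := hK0.trans_le hKm
          refine ((T n).integral_inv_phi_sq_le_of_mass hs (by positivity) hm0 hx'c hcy hy).trans ?_
          rw [← hsK]
          refine inv_anti₀ (by positivity) ?_
          have : 0 ≤ s * (T n).mass x' * (c - x') := by
            have : 0 ≤ c - x' := by linarith
            positivity
          nlinarith [mul_le_mul_of_nonneg_left hKm hs.le]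
      linarith
    · -- Case 2: heavy end: `L < ∞`, unbounded mass
      push Not at hbdd
      set K : ℝ := 4 / (s * ε) with hK
      have hK0 : 0 < K := by positivity
      have hsK : (s * K)⁻¹ = ε / 4 := by rw [hK]; field_simp
      obtain ⟨a₀, ha₀, hKa₀⟩ := hbdd K
      obtain ⟨X, hX, ha₀X, hXT, hXc⟩ := exists_good_ge hconv ha₀
      have hKX : K < S.mass X := hKa₀.trans_le (S.monotoneOn_mass ha₀ hX ha₀X)
      refine ⟨X, hX, hXT, hXc, weyl_le_of_tails hT hs ?_⟩
      have hmn : ∀ᶠ n in atTop, K ≤ (T n).mass X := hXc.eventually (Ici_mem_nhds hKX)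
      filter_upwards [hXT, hmn] with n hnX hnm
      refine ⟨hnX, fun y hy hXy => ?_⟩
      have hm0 : 0 < (T n).mass X := hK0.trans_le hnm
      refine ((T n).integral_inv_phi_sq_le_of_mass hs hX.1 hm0 le_rfl hXy hy).trans ?_
      rw [sub_self, mul_zero, add_zero, mul_one]
      calc (s * (T n).mass X)⁻¹ ≤ (s * K)⁻¹ :=
            inv_anti₀ (by positivity) (mul_le_mul_of_nonneg_left hnm hs.le)
        _ = ε / 4 := hsK
        _ ≤ ε := by linarith

/-- **The continuity theorem for strings at `z = -s`** (Kasahara; Kotani–Watanabe): if the mass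
functions of the strings `T_n` converge to that of `S` at almost every point of `[0, L)` (the point
lying eventually in `T_n`), and explode beyond `L` (for `x` with `L < x`: eventually `T_n` ends
before `x` or `m_{T_n}(x)` exceeds any given bound), then `q_{T_n}(-s) → q_S(-s)` for `s > 0`.
[cite: KotaniWatanabe1982, §2] -/
theorem tendsto_weyl_neg_of_mass_tendsto (hS : ¬ S.IsTrivial) (hT : ∀ n, ¬ (T n).IsTrivial)
    {s : ℝ} (hs : 0 < s)
    (hconv : ∀ᵐ x : ℝ, x ∈ S.dom → ((∀ᶠ n in atTop, x ∈ (T n).dom) ∧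
      Tendsto (fun n => (T n).mass x) atTop (𝓝 (S.mass x))))
    (hexpl : ∀ x : ℝ, S.length < ENNReal.ofReal x → ∀ K : ℝ,
      ∀ᶠ n in atTop, x ∉ (T n).dom ∨ K ≤ (T n).mass x) :
    Tendsto (fun n => ((T n).principalWeylFunction (-(s : ℂ))).re) atTop
      (𝓝 ((S.principalWeylFunction (-(s : ℂ))).re)) := by
  haveI := S.toEnd_neBot
  set Q := (S.principalWeylFunction (-(s : ℂ))).re with hQ
  obtain ⟨hSt, hQpos, -⟩ := S.tendsto_principalWeylFunction_of_neg hS (z := -(s : ℂ)) (by simp)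
    (by simpa using hs)
  -- interior convergence of the Weyl quotient at good points
  have hA : ∀ X ∈ S.dom, (∀ᶠ n in atTop, X ∈ (T n).dom) →
      Tendsto (fun n => (T n).mass X) atTop (𝓝 (S.mass X)) → ∀ η > 0, ∀ᶠ n in atTop,
        X ∈ (T n).dom ∧ |((T n).psi (-(s : ℂ)) X / (T n).phi (-(s : ℂ)) X).re -
          (S.psi (-(s : ℂ)) X / S.phi (-(s : ℂ)) X).re| ≤ η := by
    intro X hX hXT hXc η hη
    have hae : ∀ᵐ t ∂(volume.restrict (Icc 0 X)),
        Tendsto (fun n => (T n).mass t) atTop (𝓝 (S.mass t)) := by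
      rw [ae_restrict_iff' measurableSet_Icc]
      filter_upwards [hconv] with t ht htI
      exact (ht (S.Icc_subset_dom hX htI)).2
    have hη' : 0 < η / (2 * X + 1) := by have := hX.1; positivity
    filter_upwards [tendsto_phi_neg_uniformly T S hs hX hXT hae hXc _ hη', hXT] with n hn hnX
    refine ⟨hnX, (KreinString.abs_psi_div_phi_sub_le (T n) S hs.le hX hnX hn).trans ?_⟩
    rw [mul_div_assoc', div_le_iff₀ (by linarith [hX.1])]
    nlinarith [hX.1]
  rw [tendsto_order]
  constructor
  · -- lower bound: `Q - ε < Q_n` eventually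
    intro b hb
    -- a point `x₁` with `ψ/φ(x₁) > b`, then a good `X ≥ x₁`
    have hev : ∀ᶠ x in S.toEnd, x ∈ S.dom ∧ b < (S.psi (-(s : ℂ)) x / S.phi (-(s : ℂ)) x).re := by
      filter_upwards [S.eventually_mem_dom_ge S.zero_mem_dom,
        ((Complex.continuous_re.tendsto _).comp hSt).eventually (Ioi_mem_nhds hb)] with x hx hx'
      exact ⟨hx.1, hx'⟩
    obtain ⟨x₁, hx₁, hbx₁⟩ := hev.exists
    obtain ⟨X, hX, hx₁X, hXT, hXc⟩ := exists_good_ge hconv hx₁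
    have hbX : b < (S.psi (-(s : ℂ)) X / S.phi (-(s : ℂ)) X).re :=
      hbx₁.trans_le (S.psi_div_phi_neg_re_mono hs.le hX hx₁X)
    set η := ((S.psi (-(s : ℂ)) X / S.phi (-(s : ℂ)) X).re - b) / 2 with hη
    have hη0 : 0 < η := by rw [hη]; linarith
    filter_upwards [hA X hX hXT hXc η hη0] with n hn
    have h1 := (T n).psi_div_phi_neg_re_le_weyl (hT n) hs hn.1
    have h2 := (abs_le.1 hn.2).1
    linarith
  · -- upper bound: `Q_n < Q + ε` eventually
    intro b hb
    set ε := b - Q with hε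
    have hε0 : 0 < ε := by rw [hε]; linarith
    -- a good point `X` with uniformly small tails beyond it
    have key : ∃ X ∈ S.dom, (∀ᶠ n in atTop, X ∈ (T n).dom) ∧
        Tendsto (fun n => (T n).mass X) atTop (𝓝 (S.mass X)) ∧
        ∀ᶠ n in atTop, X ∈ (T n).dom ∧ ((T n).principalWeylFunction (-(s : ℂ))).re ≤
          ((T n).psi (-(s : ℂ)) X / (T n).phi (-(s : ℂ)) X).re + ε / 2 :=
      exists_good_tail_le hS hT hs hconv hexpl (by positivity)
    obtain ⟨X, hX, hXT, hXc, htail⟩ := key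
    filter_upwards [hA X hX hXT hXc (ε / 4) (by positivity), htail] with n hn hnt
    have h1 := S.psi_div_phi_neg_re_le_weyl hS hs hX
    have h2 := (abs_le.1 hn.2).2
    have : ((T n).principalWeylFunction (-(s : ℂ))).re ≤ Q + 3 * ε / 4 := by linarith [hnt.2]
    rw [hε] at this
    linarith

end Continuity

end KreinString

end Literature.Analysis.InverseSpectral

end
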